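import Literature.Analysis.FluidPDE.MollifiedSolenoidalTest
import Literature.Analysis.FluidPDE.SolenoidalTruncationSup
import Literature.Analysis.FluidPDE.HeatExtensionVanishingAtInfinity
import Mathlib.Topology.UniformSpace.HeineCantor
import HarnessLib

/-!
# Sup-norm density of smooth compactly supported solenoidal fields in `C₀,σ`

Analysis/FluidPDE support file (everything proved; no definitions, no named facts).  On a
three-dimensional real inner product space, every continuous, weakly divergence-free field `V`
vanishing at infinity is a **uniform** limit of smooth, compactly supported, divergence-free
fields (`exists_divFree_test_sup_approx`):

1. mollify — `V` is uniformly continuous (continuous and `C₀`), so `φ_δ ⋆ V → V` uniformly;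
   the mollification is smooth and (classically) divergence free
   (`isDivFree_normed_convolution_of_isWeaklyDivFree`);
2. truncate solenoidally — `Ψ_R(V₁) = χ_R V₁ + Dχ_R(x)F − Dχ_R(F)x` with the Poincaré field
   `F = poincareField V₁ = ∫₀¹ t V₁(t·) dt` (`SolenoidalTruncation.lean`); the error is `0` inside
   `B(0, R)` and at most `‖V₁ x‖ + 4C₁‖F x‖` outside (`norm_solenoidalTruncation_sub_le`), and
   both terms are small far away because `V₁ → 0` at infinity and the Poincaré field of a
   bounded field vanishing at infinity vanishes at infinity
   (`norm_poincareField_le_of_norm_le`: `‖F(x)‖ ≤ A M/‖x‖ + η` once `‖V₁‖ ≤ η` off `B(0, A)`).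

This is the `C₀` analogue of the `L²_σ`/`H¹_σ` density of `C^∞_{c,σ}`
(Galdi 2011, Thm. III.4.3; the tree's `exists_divFreeTest_tendsto_eLpNorm`,
`exists_isDivFree_test_approx`).

## Mathlib / tree search

Tree: `poincareField(_apply)`, `solenoidalTruncation`, `contDiff_/hasCompactSupport_/isDivFree_
solenoidalTruncation`, `norm_solenoidalTruncation_sub_le`,
`solenoidalTruncation_sub_eq_zero_of_norm_lt`, `exists_norm_fderiv_cutoff_le`,
`contDiff_normed_convolution_of_locallyIntegrable`,
`isDivFree_normed_convolution_of_isWeaklyDivFree`, `tendsto_cocompact_nhds_zero_iff_norm`,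
`exists_bound_of_tendsto_cocompact_nhds_zero`. Mathlib: `ContDiffBump`,
`ContDiffBump.dist_normed_convolution_le`, `Continuous.uniformContinuous_of_tendsto_cocompact`,
`intervalIntegral.norm_integral_le_of_norm_le_const`.

## References

* G. P. Galdi, *An Introduction to the Mathematical Theory of the Navier–Stokes Equations*,
  2nd ed. 2011, Thm. III.4.3 (density of solenoidal test fields). [Galdi2011]
-/

noncomputable section

open MeasureTheory Set Function Filter Metric
open _root_.Topology
open scoped Convolution

namespace Literature.Analysis.FluidPDE

variable {E : Type*} [NormedAddCommGroup E] [InnerProductSpace ℝ E] [FiniteDimensional ℝ E]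
  [MeasurableSpace E] [BorelSpace E]

omit [FiniteDimensional ℝ E] [MeasurableSpace E] [BorelSpace E] in
/-- **The Poincaré field of a bounded field which is small far away is small far away**: if
`‖V‖ ≤ M` everywhere and `‖V z‖ ≤ η` for `‖z‖ ≥ A` (`A > 0`, `η ≥ 0`), then for `‖x‖ ≥ A`,
`‖∫₀¹ t V(t x) dt‖ ≤ A M/‖x‖ + η`: for `t‖x‖ < A` the integrand has norm `t‖V(tx)‖ ≤ (A/‖x‖) M`,
and for `t‖x‖ ≥ A` it has norm `≤ t η ≤ η`. [folklore] -/
theorem norm_poincareField_le_of_norm_le {V : E → E} {M η A : ℝ} (hM : ∀ z, ‖V z‖ ≤ M)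
    (hA : 0 < A) (hη : 0 ≤ η) (hfar : ∀ z, A ≤ ‖z‖ → ‖V z‖ ≤ η) {x : E} (hx : A ≤ ‖x‖) :
    ‖poincareField V x‖ ≤ A * M / ‖x‖ + η := by
  have hM0 : 0 ≤ M := (norm_nonneg _).trans (hM 0)
  have hxpos : 0 < ‖x‖ := hA.trans_le hx
  have h1 : 0 ≤ A * M / ‖x‖ := by positivity
  rw [poincareField_apply]
  have key : ∀ t ∈ Set.uIoc (0 : ℝ) 1, ‖t • V (t • x)‖ ≤ A * M / ‖x‖ + η := by
    intro t ht
    rw [uIoc_of_le zero_le_one] at ht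
    have ht0 : 0 < t := ht.1
    rw [norm_smul, Real.norm_of_nonneg ht0.le]
    by_cases htx : t * ‖x‖ < A
    · have ht' : t ≤ A / ‖x‖ := by rw [le_div_iff₀ hxpos]; exact htx.le
      calc t * ‖V (t • x)‖ ≤ (A / ‖x‖) * M :=
            mul_le_mul ht' (hM _) (norm_nonneg _) (by positivity)
        _ = A * M / ‖x‖ := by ring
        _ ≤ A * M / ‖x‖ + η := le_add_of_nonneg_right hη
    · have hz : A ≤ ‖t • x‖ := by
        rw [norm_smul, Real.norm_of_nonneg ht0.le]; exact not_lt.1 htx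
      calc t * ‖V (t • x)‖ ≤ 1 * η := mul_le_mul ht.2 (hfar _ hz) (norm_nonneg _) zero_le_one
        _ = η := one_mul η
        _ ≤ A * M / ‖x‖ + η := le_add_of_nonneg_left h1
  have h := intervalIntegral.norm_integral_le_of_norm_le_const (a := 0) (b := 1)
    (f := fun t : ℝ => t • V (t • x)) key
  simpa using h

omit [FiniteDimensional ℝ E] [MeasurableSpace E] [BorelSpace E] in
/-- The Poincaré field of a bounded field vanishing at infinity vanishes at infinity (on a
proper space). [folklore] -/
theorem tendsto_poincareField_cocompact [ProperSpace E] {V : E → E} {M : ℝ} (hM : ∀ z, ‖V z‖ ≤ M)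
    (hV0 : Tendsto V (cocompact E) (𝓝 0)) : Tendsto (poincareField V) (cocompact E) (𝓝 0) := by
  have hM0 : 0 ≤ M := (norm_nonneg _).trans (hM 0)
  rw [tendsto_cocompact_nhds_zero_iff_norm] at hV0 ⊢
  intro ε hε
  obtain ⟨A₀, hA₀⟩ := hV0 (ε / 2) (half_pos hε)
  set A : ℝ := max A₀ 1 with hA
  have hA0 : 0 < A := lt_of_lt_of_le one_pos (le_max_right _ _)
  refine ⟨max A (2 * A * M / ε), fun x hx => ?_⟩
  have hxA : A ≤ ‖x‖ := (le_max_left _ _).trans hx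
  have hxpos : 0 < ‖x‖ := hA0.trans_le hxA
  have h1 := norm_poincareField_le_of_norm_le hM hA0 (half_pos hε).le
    (fun z hz => hA₀ z ((le_max_left _ _).trans hz)) hxA
  have h2 : A * M / ‖x‖ ≤ ε / 2 := by
    rw [div_le_iff₀ hxpos]
    have h3 : 2 * A * M / ε ≤ ‖x‖ := (le_max_right _ _).trans hx
    rw [div_le_iff₀ hε] at h3
    linarith
  linarith

/-- **Sup-norm density of `C^∞_{c,σ}` in `C₀,σ` (dimension three).** A continuous, weakly
divergence-free field `V` vanishing at infinity is, for every `ε > 0`, uniformly `ε`-close to a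
smooth, compactly supported, divergence-free field: mollify (`V` is uniformly continuous, the
mollification is smooth and divergence free) and truncate solenoidally at a large radius
(the error `‖V₁‖ + 4C₁‖F‖` off `B(0, R)` is small since `V₁` and its Poincaré field `F` vanish at
infinity) (Galdi 2011, Thm. III.4.3 in `C₀`). [cite: Galdi2011, Thm. III.4.3] -/
theorem exists_divFree_test_sup_approx (hE : Module.finrank ℝ E = 3) {V : E → E}
    (hVc : Continuous V) (hV0 : Tendsto V (cocompact E) (𝓝 0)) (hVd : IsWeaklyDivFree V)
    {ε : ℝ} (hε : 0 < ε) :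
    ∃ W : E → E, ContDiff ℝ (⊤ : ℕ∞) W ∧ HasCompactSupport W ∧ VectorCalculus.IsDivFree W ∧
      ∀ x, ‖W x - V x‖ ≤ ε := by
  obtain ⟨C₁, hC₁, hcut⟩ := exists_norm_fderiv_cutoff_le (E := E)
  set ε₁ : ℝ := ε / (3 + 12 * C₁) with hε₁
  have hε₁0 : 0 < ε₁ := by positivity
  -- Step 1: mollification, uniformly `ε₁`-close
  have hUC : UniformContinuous V := hVc.uniformContinuous_of_tendsto_cocompact hV0
  obtain ⟨δ, hδ, hδV⟩ := Metric.uniformContinuous_iff.1 hUC ε₁ hε₁0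
  let φ : ContDiffBump (0 : E) := ⟨δ / 4, δ / 2, by positivity, by linarith⟩
  set V₁ : E → E := φ.normed volume ⋆[ContinuousLinearMap.lsmul ℝ ℝ, volume] V with hV₁
  have hmoll : ∀ x, ‖V₁ x - V x‖ ≤ ε₁ := by
    intro x
    rw [← dist_eq_norm]
    refine ContDiffBump.dist_normed_convolution_le hVc.aestronglyMeasurable fun y hy => ?_
    rw [mem_ball] at hy
    have hy' : dist y x < δ := by
      have : φ.rOut = δ / 2 := rfl
      linarith
    exact (hδV hy').le
  have hV₁s : ContDiff ℝ (⊤ : ℕ∞) V₁ :=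
    contDiff_normed_convolution_of_locallyIntegrable φ hVc.locallyIntegrable
  have hV₁d : VectorCalculus.IsDivFree V₁ :=
    isDivFree_normed_convolution_of_isWeaklyDivFree φ hVc.locallyIntegrable hVd
  -- bounds for the mollified field
  obtain ⟨M₀, -, hM₀⟩ := exists_bound_of_tendsto_cocompact_nhds_zero hVc hV0
  have hsplit : ∀ z, ‖V₁ z‖ ≤ ‖V z‖ + ‖V₁ z - V z‖ := fun z => by
    calc ‖V₁ z‖ = ‖V z + (V₁ z - V z)‖ := by rw [add_sub_cancel]
      _ ≤ ‖V z‖ + ‖V₁ z - V z‖ := norm_add_le _ _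
  have hM : ∀ z, ‖V₁ z‖ ≤ M₀ + ε₁ := fun z =>
    (hsplit z).trans (add_le_add (hM₀ z) (hmoll z))
  obtain ⟨A₀, hA₀⟩ := tendsto_cocompact_nhds_zero_iff_norm.1 hV0 ε₁ hε₁0
  set A : ℝ := max A₀ 1 with hA
  have hA0 : 0 < A := lt_of_lt_of_le one_pos (le_max_right _ _)
  have hfar : ∀ z, A ≤ ‖z‖ → ‖V₁ z‖ ≤ 2 * ε₁ := fun z hz => by
    calc ‖V₁ z‖ ≤ ‖V z‖ + ‖V₁ z - V z‖ := hsplit z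
      _ ≤ ε₁ + ε₁ := add_le_add (hA₀ z ((le_max_left _ _).trans hz)) (hmoll z)
      _ = 2 * ε₁ := by ring
  -- Step 2: the truncation radius
  set R : ℝ := max A (A * (M₀ + ε₁) / ε₁) with hR
  have hRA : A ≤ R := le_max_left _ _
  have hR0 : 0 < R := hA0.trans_le hRA
  have hF : ∀ x, R ≤ ‖x‖ → ‖poincareField V₁ x‖ ≤ 3 * ε₁ := fun x hx => by
    have h1 := norm_poincareField_le_of_norm_le hM hA0 (by positivity : (0 : ℝ) ≤ 2 * ε₁) hfar
      (hRA.trans hx)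
    have hxpos : 0 < ‖x‖ := hR0.trans_le hx
    have h2 : A * (M₀ + ε₁) / ‖x‖ ≤ ε₁ := by
      rw [div_le_iff₀ hxpos]
      have h3 : A * (M₀ + ε₁) / ε₁ ≤ ‖x‖ := (le_max_right _ _).trans hx
      rw [div_le_iff₀ hε₁0] at h3
      linarith
    linarith
  refine ⟨solenoidalTruncation V₁ R, contDiff_solenoidalTruncation hV₁s R,
    hasCompactSupport_solenoidalTruncation hR0,
    isDivFree_solenoidalTruncation hE (hV₁s.of_le (by exact_mod_cast le_top)) hV₁d R, fun x => ?_⟩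
  have htrunc : ‖solenoidalTruncation V₁ R x - V₁ x‖ ≤ (2 + 12 * C₁) * ε₁ := by
    rcases lt_or_ge ‖x‖ R with hxR | hxR
    · rw [solenoidalTruncation_sub_eq_zero_of_norm_lt hR0 hxR, norm_zero]
      positivity
    · calc ‖solenoidalTruncation V₁ R x - V₁ x‖
          ≤ ‖V₁ x‖ + 4 * C₁ * ‖poincareField V₁ x‖ := norm_solenoidalTruncation_sub_le hC₁ hcut hR0 x
        _ ≤ 2 * ε₁ + 4 * C₁ * (3 * ε₁) := by
            gcongr
            exacts [hfar x (hRA.trans hxR), hF x hxR]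
        _ = (2 + 12 * C₁) * ε₁ := by ring
  calc ‖solenoidalTruncation V₁ R x - V x‖
      = ‖(solenoidalTruncation V₁ R x - V₁ x) + (V₁ x - V x)‖ := by rw [sub_add_sub_cancel]
    _ ≤ ‖solenoidalTruncation V₁ R x - V₁ x‖ + ‖V₁ x - V x‖ := norm_add_le _ _
    _ ≤ (2 + 12 * C₁) * ε₁ + ε₁ := add_le_add htrunc (hmoll x)
    _ = ε := by
        rw [hε₁]
        field_simp
        ring

end Literature.Analysis.FluidPDE

end
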